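import Literature.Barriers.Schanuel.NesterenkoModularScopeSeries
import Mathlib.Algebra.MvPolynomial.Derivation
import Mathlib.Algebra.MvPolynomial.PDeriv
import Mathlib.RingTheory.PowerSeries.Derivative
import HarnessLib

/-!
# Barrier (Schanuel) `NesterenkoModularScope`: Nesterenko's differential operator `D` and the polynomials `B = (12z)^T (z⁻¹D)^T A` (LNM 1752, Ch. 3, (14), (15), (19))

`Literature/Barriers/Schanuel/NesterenkoModularScopeOperator.lean` — the ALGEBRAIC half of
LNM 1752 Ch. 3 Lemma 3.4 (the named fact `NesterenkoPhilippon2001_ch3_lemma_3_4` of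
`NesterenkoModularScopeSeries.lean`): the operator (15)
`D = z ∂/∂z + (1/12)(x₁² − x₂) ∂/∂x₁ + (1/3)(x₁x₂ − x₃) ∂/∂x₂ + (1/2)(x₁x₃ − x₂²) ∂/∂x₃`,
integralised as `12D` (`nesterenkoD12`, a `Derivation` of `ℤ[z, x₁, x₂, x₃]`), the polynomials
`B_T = ∏_{k<T} (12D − 12k) A = (12z)^T (z⁻¹D)^T A ∈ ℤ[z, x₁, x₂, x₃]` of Lemma 3.4 / (19)
(`nesterenkoB A T`), and — from Ramanujan's system (2) (the named fact `ramanujan1916_system`) —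
the formal version of identity (14): `(12D E)(z, P, Q, R) = 12 θ (E(z, P, Q, R))`, `θ = z d/dz`
(`ramanujanComposite_nesterenkoD12`), whence the Taylor coefficients of `B_T(z, P, Q, R)` are
`12^T n(n−1)⋯(n−T+1) bₙ` (`coeff_ramanujanComposite_nesterenkoB`), i.e.
`B_T(z, P(z), Q(z), R(z)) = (12z)^T F^{(T)}(z)` at the level of formal series. The analytic half of
Lemma 3.4 (Lemmas 3.2, 3.3 and the Cauchy estimates giving (18)) is not here.

## References

* [NesterenkoPhilippon2001] LNM 1752 (2001), Ch. 3 §1 (2), §3 (14), (15), (19), Lemma 3.4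
  (pp. 27, 36–37).
-/

noncomputable section

open MvPolynomial
open Literature.NumberTheory.Transcendental

namespace Literature.Barriers.Schanuel

/-! ### `θ = z d/dz` is a derivation -/

/-- `θ f = z · f'`. [folklore] -/
theorem ramanujanTheta_eq_X_mul_derivative {R : Type*} [CommRing R] (f : PowerSeries R) :
    ramanujanTheta f = PowerSeries.X * PowerSeries.derivative R f := by
  ext n
  rw [coeff_ramanujanTheta]
  cases n with
  | zero => simp [PowerSeries.coeff_zero_X_mul]
  | succ n =>
    rw [PowerSeries.coeff_succ_X_mul, PowerSeries.coeff_derivative]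
    push_cast
    ring

/-- `θ` is additive. [folklore] -/
theorem ramanujanTheta_add {R : Type*} [CommRing R] (f g : PowerSeries R) :
    ramanujanTheta (f + g) = ramanujanTheta f + ramanujanTheta g := by
  simp only [ramanujanTheta_eq_X_mul_derivative, map_add, mul_add]

/-- Leibniz rule for `θ`. [folklore] -/
theorem ramanujanTheta_mul {R : Type*} [CommRing R] (f g : PowerSeries R) :
    ramanujanTheta (f * g) = ramanujanTheta f * g + f * ramanujanTheta g := by
  simp only [ramanujanTheta_eq_X_mul_derivative, Derivation.leibniz, smul_eq_mul]
  ring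

/-- `θ` kills constants. [folklore] -/
theorem ramanujanTheta_C {R : Type*} [CommRing R] (a : R) :
    ramanujanTheta (PowerSeries.C a) = 0 := by
  ext n
  rw [coeff_ramanujanTheta, PowerSeries.coeff_C]
  split_ifs with h
  · subst h; simp
  · simp

/-- `θ z = z`. [folklore] -/
theorem ramanujanTheta_X {R : Type*} [CommRing R] :
    ramanujanTheta (PowerSeries.X : PowerSeries R) = PowerSeries.X := by
  ext n
  rw [coeff_ramanujanTheta, PowerSeries.coeff_X]
  split_ifs with h
  · subst h; simp
  · simp

/-- `θ` kills integer constants. [folklore] -/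
theorem ramanujanTheta_intCast {R : Type*} [CommRing R] (a : ℤ) :
    ramanujanTheta ((a : PowerSeries R)) = 0 := by
  rw [← map_intCast (PowerSeries.C (R := R)), ramanujanTheta_C]

/-! ### The operator `12D` (15) and the identity (14) -/

/-- Nesterenko's operator (15) multiplied by `12`:
`12D = 12 z ∂/∂z + (x₁² − x₂) ∂/∂x₁ + 4(x₁x₂ − x₃) ∂/∂x₂ + 6(x₁x₃ − x₂²) ∂/∂x₃`, the derivation of
`ℤ[z, x₁, x₂, x₃]` determined by its values on the variables.
[cite: NesterenkoPhilippon2001, Ch. 3 §3 (15) (p. 36)] -/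
def nesterenkoD12 : Derivation ℤ (MvPolynomial (Fin 4) ℤ) (MvPolynomial (Fin 4) ℤ) :=
  MvPolynomial.mkDerivation ℤ
    ![12 • X 0, X 1 ^ 2 - X 2, 4 • (X 1 * X 2 - X 3), 6 • (X 1 * X 3 - X 2 ^ 2)]

/-- Values of `12D` on the variables. [cite: NesterenkoPhilippon2001, Ch. 3 §3 (15) (p. 36)] -/
theorem nesterenkoD12_X (i : Fin 4) : nesterenkoD12 (X i) =
    ![12 • X 0, X 1 ^ 2 - X 2, 4 • (X 1 * X 2 - X 3), 6 • (X 1 * X 3 - X 2 ^ 2)] i := by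
  simp [nesterenkoD12, MvPolynomial.mkDerivation_X]

/-- **Identity (14), formal version**: under Ramanujan's system (2),
`(12D E)(z, P, Q, R) = 12 θ (E(z, P, Q, R))` for every `E ∈ ℤ[z, x₁, x₂, x₃]`
(`d/dz E(z, P, Q, R) = z⁻¹ (DE)(z, P, Q, R)`). [cite: NesterenkoPhilippon2001, Ch. 3 §3 (14) (p. 36)] -/
theorem ramanujanComposite_nesterenkoD12 (hsys : ramanujan1916_system) (E : MvPolynomial (Fin 4) ℤ) :
    ramanujanComposite (nesterenkoD12 E) = 12 • ramanujanTheta (ramanujanComposite E) := by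
  have hid : Int.castRingHom ℤ = RingHom.id ℤ := RingHom.ext_int _ _
  obtain ⟨h1, h2, h3⟩ := hsys
  -- the composite as the ring hom `φ = aeval (z, P, Q, R)`
  set v : Fin 4 → PowerSeries ℤ :=
    ![PowerSeries.X, ramanujanPSeries, ramanujanQSeries, ramanujanRSeries] with hv
  have hcomp : ∀ p : MvPolynomial (Fin 4) ℤ, ramanujanComposite p = MvPolynomial.aeval v p := by
    intro p
    unfold ramanujanComposite
    simp [hid, hv]
  -- the identity on the generators = Ramanujan's system
  have hgen : ∀ i : Fin 4, MvPolynomial.aeval v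
      ((![12 • X 0, X 1 ^ 2 - X 2, 4 • (X 1 * X 2 - X 3), 6 • (X 1 * X 3 - X 2 ^ 2)] :
        Fin 4 → MvPolynomial (Fin 4) ℤ) i) = 12 • ramanujanTheta (v i) := by
    intro i
    fin_cases i
    · simp [hv, ramanujanTheta_X]
    · have e2 : v 2 = ramanujanQSeries := rfl
      simp only [Fin.mk_one, Matrix.cons_val_one, Matrix.cons_val_zero, map_sub, map_pow,
        MvPolynomial.aeval_X, nsmul_eq_mul, e2]
      have e1 : v 1 = ramanujanPSeries := rfl
      rw [e1, ← h1]
      push_cast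
      ring
    · have e1 : v 1 = ramanujanPSeries := rfl
      have e2 : v 2 = ramanujanQSeries := rfl
      have e3 : v 3 = ramanujanRSeries := rfl
      simp only [Fin.reduceFinMk, Matrix.cons_val, map_sub, map_mul, MvPolynomial.aeval_X,
        nsmul_eq_mul, map_natCast, e1, e2, e3, ← h2]
      push_cast
      ring
    · have e1 : v 1 = ramanujanPSeries := rfl
      have e2 : v 2 = ramanujanQSeries := rfl
      have e3 : v 3 = ramanujanRSeries := rfl
      simp only [Fin.reduceFinMk, Matrix.cons_val, map_sub, map_mul, map_pow,
        MvPolynomial.aeval_X, nsmul_eq_mul, map_natCast, e1, e2, e3, ← h3]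
      push_cast
      ring
  have key : ∀ E : MvPolynomial (Fin 4) ℤ,
      MvPolynomial.aeval v (nesterenkoD12 E) = 12 • ramanujanTheta (MvPolynomial.aeval v E) := by
    intro E
    induction E using MvPolynomial.induction_on with
    | C a =>
      rw [MvPolynomial.derivation_C, map_zero, MvPolynomial.aeval_C, ← PowerSeries.C_eq_algebraMap,
        ramanujanTheta_C, smul_zero]
    | add p q hp hq => rw [map_add, map_add, map_add, hp, hq, ramanujanTheta_add, smul_add]
    | mul_X p i hp =>
      rw [Derivation.leibniz, smul_eq_mul, smul_eq_mul, map_add, map_mul, map_mul, hp, map_mul,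
        ramanujanTheta_mul, nesterenkoD12_X, hgen i, MvPolynomial.aeval_X]
      simp only [nsmul_eq_mul]
      push_cast
      ring
  rw [hcomp, hcomp]
  exact key E


/-! ### The polynomials `B_T = ∏_{k<T} (12D − 12k) A` and their Taylor coefficients -/

/-- The composite is a ring homomorphism: differences. [folklore] -/
theorem ramanujanComposite_sub (p q : MvPolynomial (Fin 4) ℤ) :
    ramanujanComposite (p - q) = ramanujanComposite p - ramanujanComposite q := by
  unfold ramanujanComposite
  exact map_sub _ _ _

/-- The composite is a ring homomorphism: integer multiples. [folklore] -/
theorem ramanujanComposite_zsmul (m : ℤ) (p : MvPolynomial (Fin 4) ℤ) :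
    ramanujanComposite (m • p) = m • ramanujanComposite p := by
  unfold ramanujanComposite
  exact map_zsmul _ _ _

/-- `B_T = (12D − 12(T−1)) ⋯ (12D − 12·0) A = 12^T ∏_{k<T} (D − k) A = (12z)^T (z⁻¹D)^T A` by (19).
[cite: NesterenkoPhilippon2001, Ch. 3 Lemma 3.4 and (19) (pp. 36–37)] -/
def nesterenkoB (A : MvPolynomial (Fin 4) ℤ) : ℕ → MvPolynomial (Fin 4) ℤ
  | 0 => A
  | T + 1 => nesterenkoD12 (nesterenkoB A T) - (12 * (T : ℤ)) • nesterenkoB A T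

/-- `B_0 = A`. [folklore] -/
@[simp] theorem nesterenkoB_zero (A : MvPolynomial (Fin 4) ℤ) : nesterenkoB A 0 = A := rfl

/-- `B_{T+1} = (12D − 12T) B_T`. [folklore] -/
theorem nesterenkoB_succ (A : MvPolynomial (Fin 4) ℤ) (T : ℕ) :
    nesterenkoB A (T + 1) = nesterenkoD12 (nesterenkoB A T) - (12 * (T : ℤ)) • nesterenkoB A T :=
  rfl

/-- **`B_T(z, P, Q, R) = (12z)^T F^{(T)}(z)` coefficientwise**: under Ramanujan's system, the `n`-th
Taylor coefficient of `B_T(z, P(z), Q(z), R(z))` is `12^T · n(n−1)⋯(n−T+1) · bₙ`, `bₙ` the `n`-th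
Taylor coefficient of `F = A(z, P, Q, R)`. [cite: NesterenkoPhilippon2001, Ch. 3 §3 proof of Lemma 3.4 ((14), (19), p. 37)] -/
theorem coeff_ramanujanComposite_nesterenkoB (hsys : ramanujan1916_system)
    (A : MvPolynomial (Fin 4) ℤ) (T n : ℕ) :
    PowerSeries.coeff n (ramanujanComposite (nesterenkoB A T)) =
      12 ^ T * (∏ k ∈ Finset.range T, ((n : ℤ) - k)) *
        PowerSeries.coeff n (ramanujanComposite A) := by
  induction T with
  | zero => simp
  | succ T ih =>
    rw [nesterenkoB_succ, ramanujanComposite_sub, ramanujanComposite_zsmul,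
      ramanujanComposite_nesterenkoD12 hsys, map_sub, map_nsmul, map_zsmul, coeff_ramanujanTheta,
      ih, Finset.prod_range_succ, pow_succ]
    simp only [nsmul_eq_mul, zsmul_eq_mul]
    push_cast
    ring

/-- In particular the first `T` Taylor coefficients of `B_T(z, P, Q, R)` vanish (the factor `k = n`
of `∏_{k<T} (n − k)`), and `ord B_T(z, P, Q, R) ≥ ord A(z, P, Q, R)`. [folklore] -/
theorem coeff_ramanujanComposite_nesterenkoB_eq_zero (hsys : ramanujan1916_system)
    (A : MvPolynomial (Fin 4) ℤ) {T n : ℕ} (hn : n < T) :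
    PowerSeries.coeff n (ramanujanComposite (nesterenkoB A T)) = 0 := by
  rw [coeff_ramanujanComposite_nesterenkoB hsys]
  have : (∏ k ∈ Finset.range T, ((n : ℤ) - k)) = 0 :=
    Finset.prod_eq_zero (Finset.mem_range.mpr hn) (by simp)
  rw [this, mul_zero, zero_mul]

end Literature.Barriers.Schanuel

end
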